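import Summits.Ventures.CertifiedManyBodySolver.Downfold.EmeryOrbitalWeightFaceSteps
import HarnessLib

/-!
# The ANTINODAL Fermi-surface Cu-d weight OVER A TYPED BOX — the three-coordinate corner rule at fixed `t_pd` and the four-coordinate box by normalisation to `t_pd = 1`
# (INFL-3to1-B §B.90, part 2 of 2: the kinematic leg of the UPPER member `U_B∣full(w_antinode)` of the weak band-level `U` bracket, read over a box)

Venture CertifiedManyBodySolver, cell `pub/hubbard-downfold` (stage S1; INFLATION-RULES-3to1-B §B.72 (g)/(i) «the weak bracket U_B∣₀(w_node) < U_1b < U_B∣full(w_antinode)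
is construction-stable», §B.73 (the antinodal doping lever), §B.89 (c) (the nodal weight over a box), §B.90 (this file)), seat hubbard-downfold-mod-4 (technique B, g38);
namespace `Summit.Ventures.CertifiedManyBodySolver.Downfold.Emery`. Sequel of `EmeryOrbitalWeightFaceSteps` and of `EmeryOrbitalWeightFaceCoord` (the fixed-ENERGY coordinate levers of the closed form
`w_face = t_pd²faceN/(t_pd²faceN + faceR)`: `Δ ↑` and `t_pp′ ↑` in the antinodal charge-transfer regime `4(t_pp + t_pp′) ≤ Δ + ε`, `t_pp ↓` on the hole-like window),
`EmeryOrbitalWeightShell` (`dWeightFace_antitone`: `ε ↓` on the face window), the Fermi-energy levers (`EmeryChargeTransferLipschitz`, `EmeryHoppingLevers`), the scaling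
law (`EmeryScalingLaw`) and the van Hove filling (`EmeryVanHoveDoping`). Everything PROVED (0 sorry).
WHAT THIS IS NOT: a statement about any material; `U = 0` one-body kinematics of the σ (d–pₓ–p_y + t_pp + t_pp′) model; the weight enters the band-level `U` ANNEX
`U_B(w) = w²U_dd + (1 − w)²U_pp/4 + 2w(1 − w)U_dp` (`EmeryBandLevelU`, a mean-field projection — EXTRAPOLATED-grade context by R-B17, never a box member).

* §1–§3 (`EmeryOrbitalWeightFaceSteps`): scale invariance `W(Δ, a, b, c) = W(Δ/a, 1, b/a, c/a)`; hole-likeness `1 − 2ν ≤ x_VH ⇒ faceG(ε_F) ≥ 0`; the fixed-filling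
  one-coordinate steps `Δ ↑ ⇒ W ↑`, `t_pp ↑ ⇒ W ↓`, `t_pp′ ↑ ⇒ W ↑` under window/regime hypotheses at the points visited.
* §4 THE THREE-COORDINATE CORNER RULE at fixed `t_pd = a`: for every `(Δ, t_pp, t_pp′) ∈ [Δ₁, Δ₂] × [b₁, b₂] × [c₁, c₂]` at filling `ν`, under (i) hole-likeness on the box
  (`1 − 2ν ≤ x_VH`), (ii) the upper face edge at the box's top Fermi energy `E_h ≥ ε_F(Δ₁, a, b₂, c₁; ν)` (four corner inequalities, by coordinatewise concavity),
  (iii) `c₂E_h < a²`, (iv) the regime at two corners `4(b₂ + c₂) ≤ Δ₁ + E_R`, `E_R ≤ ε_F(Δ₁, a, b₁, c₂; ν)` and `4(b₁ + c₂) ≤ Δ₂ + E_v`, `E_v ≤ ε_F(Δ₂, a, b₁, c₂; ν)`: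
  **`W(Δ₁, a, b₂, c₁) ≤ W(Δ, a, b, c) ≤ W(Δ₂, a, b₁, c₂)`** (`dWeightFace_fermiEnergyOf_mem_Icc_of_mem_box3`) and its numeric form with the closed form `dWeightFaceCF`
  evaluated at the two corners' certified Fermi-energy brackets.
* §5 THE FOUR-COORDINATE BOX: a member `(Δ, a, b, c)` of `[Δ₁, Δ₂] × [a₁, a₂] × [b₁, b₂] × [c₁, c₂]` normalises to `(Δ/a, 1, b/a, c/a) ∈ [Δ₁/a₂, Δ₂/a₁] × {1} × [b₁/a₂, b₂/a₁] ×
  [c₁/a₂, c₂/a₁]` — §4 on that box gives the window (`dWeightFace_fermiEnergyOf_mem_Icc_of_mem_box4_num`); instances split the t_pd range into slabs to keep the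
  normalised box close to the members (the virtual corners `(Δ₂/a₁, 1, b₁/a₂, c₂/a₁)` are not members).

Sources: three-band model [HybertsenSchluterChristensen1989, Eq. (1)]; bilinear contour / face point [AndersenEtAl1995, §6]; [folklore] algebra.
-/

noncomputable section

namespace Summit.Ventures.CertifiedManyBodySolver.Downfold.Emery

open Real Set

/-! ## §4 The three-coordinate corner rule at fixed `t_pd` -/

section Box3

/-- The upper face edge form at energy `ε`: `faceU = 8fsD + 16fsN − cA = 8(Δ + ε)(a² − cε) + 16(2a²(b + c) + ε(b² − c²)) − ε(Δ + ε)²`. [folklore] -/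
def faceU (Δ a b c ε : ℝ) : ℝ := 8 * fsD Δ a c ε + 16 * fsN a b c ε - cA Δ ε

/-- `faceU` spelled out. [folklore] -/
theorem faceU_eq (Δ a b c ε : ℝ) :
    faceU Δ a b c ε = 8 * (Δ + ε) * (a ^ 2 - c * ε) + 16 * (2 * a ^ 2 * (c + b) + ε * (b ^ 2 - c ^ 2)) - ε * (Δ + ε) ^ 2 := by
  unfold faceU fsD fsN cA; ring

/-- `0 ≤ faceU ↔` the upper face edge `cA ≤ 8fsD + 16fsN`. [folklore] -/
theorem faceU_nonneg_iff (Δ a b c ε : ℝ) : 0 ≤ faceU Δ a b c ε ↔ cA Δ ε ≤ 8 * fsD Δ a c ε + 16 * fsN a b c ε := by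
  unfold faceU; constructor <;> intro h <;> linarith

/-- A concave quadratic on an interval is bounded below by its smaller endpoint value: `q(t) = −αt² + βt + γ`, `α ≥ 0`, `t ∈ [t₁, t₂]` ⇒
`min (q t₁) (q t₂) ≤ q t`. [folklore] -/
theorem concaveQuad_ge_min {α β γ t t₁ t₂ : ℝ} (hα : 0 ≤ α) (ht : t ∈ Icc t₁ t₂) :
    min (-α * t₁ ^ 2 + β * t₁ + γ) (-α * t₂ ^ 2 + β * t₂ + γ) ≤ -α * t ^ 2 + β * t + γ := by
  rcases eq_or_lt_of_le (ht.1.trans ht.2) with h | h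
  · have : t = t₁ := le_antisymm (h ▸ ht.2) ht.1
    rw [this]; exact min_le_left _ _
  · -- t = λ t₁ + (1 − λ) t₂ with λ = (t₂ − t)/(t₂ − t₁)
    set l := (t₂ - t) / (t₂ - t₁) with hl
    have hl0 : 0 ≤ l := div_nonneg (by linarith [ht.2]) (by linarith)
    have hl1 : l ≤ 1 := by rw [hl, div_le_one (by linarith)]; linarith [ht.1]
    have htl : t = l * t₁ + (1 - l) * t₂ := by
      rw [hl]; field_simp; ring
    have key : -α * t ^ 2 + β * t + γ - (l * (-α * t₁ ^ 2 + β * t₁ + γ) + (1 - l) * (-α * t₂ ^ 2 + β * t₂ + γ)) =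
        α * l * (1 - l) * (t₂ - t₁) ^ 2 := by rw [htl]; ring
    have hnn : 0 ≤ α * l * (1 - l) * (t₂ - t₁) ^ 2 := by
      have : 0 ≤ 1 - l := by linarith
      positivity
    have hconv : min (-α * t₁ ^ 2 + β * t₁ + γ) (-α * t₂ ^ 2 + β * t₂ + γ) ≤
        l * (-α * t₁ ^ 2 + β * t₁ + γ) + (1 - l) * (-α * t₂ ^ 2 + β * t₂ + γ) := by
      have h1 := min_le_left (-α * t₁ ^ 2 + β * t₁ + γ) (-α * t₂ ^ 2 + β * t₂ + γ)
      have h2 := min_le_right (-α * t₁ ^ 2 + β * t₁ + γ) (-α * t₂ ^ 2 + β * t₂ + γ)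
      nlinarith [mul_le_mul_of_nonneg_left h1 hl0, mul_le_mul_of_nonneg_left h2 (by linarith : 0 ≤ 1 - l)]
    linarith

/-- **THE UPPER FACE EDGE ON A BOX FROM ITS FOUR `(Δ, t_pp′)`-CORNERS** (fixed `a`, energy `ε ≥ 0`, `t_pp ≥ b₁ ≥ 0`): `faceU` is non-decreasing in `t_pp` and a concave
quadratic in `Δ` and in `t_pp′` separately, so it is bounded below on `[Δ₁, Δ₂] × [b₁, ∞) × [c₁, c₂]` by its minimum over the four corners `(Δᵢ, b₁, cⱼ)`. [folklore] -/
theorem faceU_nonneg_on_box {Δ a b c Δ₁ Δ₂ b₁ c₁ c₂ ε : ℝ} (hε : 0 ≤ ε) (hb₁ : 0 ≤ b₁) (hΔ : Δ ∈ Icc Δ₁ Δ₂) (hb : b₁ ≤ b) (hc : c ∈ Icc c₁ c₂)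
    (h11 : 0 ≤ faceU Δ₁ a b₁ c₁ ε) (h12 : 0 ≤ faceU Δ₁ a b₁ c₂ ε) (h21 : 0 ≤ faceU Δ₂ a b₁ c₁ ε) (h22 : 0 ≤ faceU Δ₂ a b₁ c₂ ε) :
    0 ≤ faceU Δ a b c ε := by
  -- step 1: lower t_pp to b₁ (faceU is non-decreasing in b for b ≥ 0, ε ≥ 0)
  have hmono : faceU Δ a b₁ c ε ≤ faceU Δ a b c ε := by
    rw [faceU_eq, faceU_eq]
    have : 0 ≤ (b - b₁) * (32 * a ^ 2 + 16 * ε * (b + b₁)) := by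
      have : 0 ≤ b + b₁ := by linarith
      have : 0 ≤ b - b₁ := by linarith
      positivity
    nlinarith
  refine le_trans ?_ hmono
  -- step 2: concave quadratic in c at fixed Δ: min over c ∈ {c₁, c₂}
  have hcq : ∀ D : ℝ, min (faceU D a b₁ c₁ ε) (faceU D a b₁ c₂ ε) ≤ faceU D a b₁ c ε := by
    intro D
    have e : ∀ x : ℝ, faceU D a b₁ x ε = -(16 * ε) * x ^ 2 + (32 * a ^ 2 - 8 * (D + ε) * ε) * x +
        (8 * (D + ε) * a ^ 2 + 32 * a ^ 2 * b₁ + 16 * ε * b₁ ^ 2 - ε * (D + ε) ^ 2) := by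
      intro x; rw [faceU_eq]; ring
    simp only [e]
    exact concaveQuad_ge_min (by positivity) hc
  -- step 3: concave quadratic in Δ at fixed c: min over Δ ∈ {Δ₁, Δ₂}
  have hDq : ∀ x : ℝ, min (faceU Δ₁ a b₁ x ε) (faceU Δ₂ a b₁ x ε) ≤ faceU Δ a b₁ x ε := by
    intro x
    have e : ∀ D : ℝ, faceU D a b₁ x ε = -ε * D ^ 2 + (8 * (a ^ 2 - x * ε) - 2 * ε ^ 2) * D +
        (8 * ε * (a ^ 2 - x * ε) + 16 * (2 * a ^ 2 * (x + b₁) + ε * (b₁ ^ 2 - x ^ 2)) - ε ^ 3) := by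
      intro D; rw [faceU_eq]; ring
    simp only [e]
    exact concaveQuad_ge_min hε hΔ
  have h1 : 0 ≤ faceU Δ a b₁ c₁ ε := le_trans (le_min h11 h21) (hDq c₁)
  have h2 : 0 ≤ faceU Δ a b₁ c₂ ε := le_trans (le_min h12 h22) (hDq c₂)
  exact le_trans (le_min h1 h2) (hcq Δ)

/-- **THE THREE-COORDINATE CORNER RULE FOR THE ANTINODAL FERMI-SURFACE Cu-d WEIGHT AT FIXED `t_pd`.** For every `(Δ, b, c) ∈ [Δ₁, Δ₂] × [b₁, b₂] × [c₁, c₂]`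
(`Δ₁ > 0`, `a > 0`, `0 ≤ c₁`, `c₂ ≤ b₁`) at filling `0 < ν < 1`, given (i) hole-likeness on the box `1 − 2ν ≤ x_VH`, (ii) a number `E_h ≥ ε_F(Δ₁, a, b₂, c₁; ν)` with
`c₂E_h < a²` and the upper face edge at `E_h` at the four corners `(Δᵢ, b₁, cⱼ)`, (iii) the antinodal charge-transfer regime at two corners: `4(b₂ + c₂) ≤ Δ₁ + E_R` with
`E_R ≤ ε_F(Δ₁, a, b₁, c₂; ν)` and `4(b₁ + c₂) ≤ Δ₂ + E_v` with `E_v ≤ ε_F(Δ₂, a, b₁, c₂; ν)`: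
**`W(Δ₁, a, b₂, c₁) ≤ W(Δ, a, b, c) ≤ W(Δ₂, a, b₁, c₂)`**, `W(θ) = dWeightFace(θ; ε_F(θ; ν))`. [folklore] -/
theorem dWeightFace_fermiEnergyOf_mem_Icc_of_mem_box3 {Δ a b c Δ₁ Δ₂ b₁ b₂ c₁ c₂ ν Eh ER Ev : ℝ} (hΔ₁ : 0 < Δ₁) (ha : 0 < a) (hc₁ : 0 ≤ c₁)
    (hcb : c₂ ≤ b₁) (hΔ : Δ ∈ Icc Δ₁ Δ₂) (hb : b ∈ Icc b₁ b₂) (hc : c ∈ Icc c₁ c₂) (hν0 : 0 < ν) (hν1 : ν < 1)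
    (hVH : ∀ Δ' b' c' : ℝ, Δ' ∈ Icc Δ₁ Δ₂ → b' ∈ Icc b₁ b₂ → c' ∈ Icc c₁ c₂ → 1 - 2 * ν ≤ xVH Δ' a b' c')
    (hEh : fermiEnergyOf Δ₁ a b₂ c₁ ν ≤ Eh) (hm : c₂ * Eh < a ^ 2)
    (hU11 : 0 ≤ faceU Δ₁ a b₁ c₁ Eh) (hU12 : 0 ≤ faceU Δ₁ a b₁ c₂ Eh) (hU21 : 0 ≤ faceU Δ₂ a b₁ c₁ Eh) (hU22 : 0 ≤ faceU Δ₂ a b₁ c₂ Eh)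
    (hER : ER ≤ fermiEnergyOf Δ₁ a b₁ c₂ ν) (hR1 : 4 * (b₂ + c₂) ≤ Δ₁ + ER)
    (hEv : Ev ≤ fermiEnergyOf Δ₂ a b₁ c₂ ν) (hR2 : 4 * (b₁ + c₂) ≤ Δ₂ + Ev) :
    dWeightFace Δ a b c (fermiEnergyOf Δ a b c ν) ∈
      Icc (dWeightFace Δ₁ a b₂ c₁ (fermiEnergyOf Δ₁ a b₂ c₁ ν)) (dWeightFace Δ₂ a b₁ c₂ (fermiEnergyOf Δ₂ a b₁ c₂ ν)) := by
  -- positivity bookkeeping on the box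
  have hΔ₂ : 0 < Δ₂ := lt_of_lt_of_le hΔ₁ (hΔ.1.trans hΔ.2)
  have hc₂ : 0 ≤ c₂ := hc₁.trans (hc.1.trans hc.2)
  have hb₁ : 0 ≤ b₁ := hc₂.trans hcb
  have hb₂ : 0 ≤ b₂ := hb₁.trans (hb.1.trans hb.2)
  have hΔ0 : 0 < Δ := lt_of_lt_of_le hΔ₁ hΔ.1
  have hc0 : 0 ≤ c := hc₁.trans hc.1
  have hb0 : 0 ≤ b := hb₁.trans hb.1
  have ha' : a ≠ 0 := ha.ne'
  have hex : ∀ {D B C : ℝ}, 0 < D → 0 ≤ B → 0 ≤ C → ∃ ε : ℝ, abFilling D a B C ε = ν :=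
    fun hD hB hC => exists_abFilling_eq hD ha' hC hB hν0 hν1
  -- the Fermi energy of every box point is ≤ Eh (levers: Δ ↓ ⇒ ε_F ↑, b ↑ ⇒ ε_F ↑, c ↓ ⇒ ε_F ↑)
  have hEmax : ∀ {D B C : ℝ}, D ∈ Icc Δ₁ Δ₂ → B ∈ Icc b₁ b₂ → C ∈ Icc c₁ c₂ → fermiEnergyOf D a B C ν ≤ Eh := by
    intro D B C hD hB hC
    have hD0 : 0 < D := lt_of_lt_of_le hΔ₁ hD.1
    have hB0 : 0 ≤ B := hb₁.trans hB.1
    have hC0 : 0 ≤ C := hc₁.trans hC.1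
    obtain ⟨δ, hDδ⟩ : ∃ δ, D = Δ₁ + δ := ⟨D - Δ₁, by ring⟩
    obtain ⟨γ, hCγ⟩ : ∃ γ, C = c₁ + γ := ⟨C - c₁, by ring⟩
    have hδ : 0 ≤ δ := by linarith [hD.1]
    have hγ : 0 ≤ γ := by linarith [hC.1]
    calc fermiEnergyOf D a B C ν ≤ fermiEnergyOf Δ₁ a B C ν := by
            rw [hDδ]; exact fermiEnergyOf_shift_le hΔ₁ ha' hC0 hB0 hδ hν0 hν1 (hex hΔ₁ hB0 hC0) (hex (by linarith) hB0 hC0)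
      _ ≤ fermiEnergyOf Δ₁ a b₂ C ν := fermiEnergyOf_mono_tpp hΔ₁.le hC0 hB0 hB.2 hν0 hν1 (hex hΔ₁ hB0 hC0) (hex hΔ₁ hb₂ hC0)
      _ ≤ fermiEnergyOf Δ₁ a b₂ c₁ ν := by
            rw [hCγ]; exact fermiEnergyOf_anti_tppP hΔ₁ ha' hc₁ hb₂ hγ hν0 hν1 (hex hΔ₁ hb₂ hc₁) (hex hΔ₁ hb₂ (by linarith))
      _ ≤ Eh := hEh
  -- the regime form: Δ₁ + ε_F(Δ₁, a, B, C) ≥ Δ₁ + ER ≥ 4(b₂ + c₂) for B ≥ b₁, C ≤ c₂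
  have hRmin : ∀ {B C : ℝ}, B ∈ Icc b₁ b₂ → C ∈ Icc c₁ c₂ → ER ≤ fermiEnergyOf Δ₁ a B C ν := by
    intro B C hB hC
    have hB0 : 0 ≤ B := hb₁.trans hB.1
    have hC0 : 0 ≤ C := hc₁.trans hC.1
    obtain ⟨γ, hCγ⟩ : ∃ γ, c₂ = C + γ := ⟨c₂ - C, by ring⟩
    have hγ : 0 ≤ γ := by linarith [hC.2]
    calc ER ≤ fermiEnergyOf Δ₁ a b₁ c₂ ν := hER
      _ ≤ fermiEnergyOf Δ₁ a b₁ C ν := by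
            rw [hCγ]; exact fermiEnergyOf_anti_tppP hΔ₁ ha' hC0 hb₁ hγ hν0 hν1 (hex hΔ₁ hb₁ hC0) (hex hΔ₁ hb₁ (by linarith))
      _ ≤ fermiEnergyOf Δ₁ a B C ν := fermiEnergyOf_mono_tpp hΔ₁.le hC0 hb₁ hB.1 hν0 hν1 (hex hΔ₁ hb₁ hC0) (hex hΔ₁ hB0 hC0)
  -- Δ + ε_F(Δ, a, B, C) ≥ Δ₁ + ε_F(Δ₁, a, B, C) (1-Lipschitz in Δ)
  have hLip : ∀ {D B C : ℝ}, D ∈ Icc Δ₁ Δ₂ → B ∈ Icc b₁ b₂ → C ∈ Icc c₁ c₂ →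
      Δ₁ + fermiEnergyOf Δ₁ a B C ν ≤ D + fermiEnergyOf D a B C ν := by
    intro D B C hD hB hC
    have hB0 : 0 ≤ B := hb₁.trans hB.1
    have hC0 : 0 ≤ C := hc₁.trans hC.1
    obtain ⟨δ, hDδ⟩ : ∃ δ, D = Δ₁ + δ := ⟨D - Δ₁, by ring⟩
    have hδ : 0 ≤ δ := by linarith [hD.1]
    have h := fermiEnergyOf_sub_le_shift (a := a) hΔ₁.le hC0 hB0 hδ hν0 hν1 (hex hΔ₁ hB0 hC0) (hex (by linarith) hB0 hC0)
    rw [hDδ]; linarith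
  -- hole-likeness at any box point
  have hGof : ∀ {D B C : ℝ}, D ∈ Icc Δ₁ Δ₂ → B ∈ Icc b₁ b₂ → C ∈ Icc c₁ c₂ → 0 ≤ faceG D a C (fermiEnergyOf D a B C ν) := by
    intro D B C hD hB hC
    exact faceG_fermiEnergyOf_nonneg_of_xVH (lt_of_lt_of_le hΔ₁ hD.1) ha' (hc₁.trans hC.1) (hb₁.trans hB.1) hν0 hν1 (hVH D B C hD hB hC)
  -- upper face edge at any box point and any energy 0 < ε ≤ Eh
  have hUof : ∀ {D B C ε : ℝ}, D ∈ Icc Δ₁ Δ₂ → B ∈ Icc b₁ b₂ → C ∈ Icc c₁ c₂ → 0 < ε → ε ≤ Eh →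
      cA D ε ≤ 8 * fsD D a C ε + 16 * fsN a B C ε := by
    intro D B C ε hD hB hC hε0 hεh
    have hC0 : 0 ≤ C := hc₁.trans hC.1
    have hU := faceU_nonneg_on_box (hε0.le.trans hεh) hb₁ hD hB.1 hC hU11 hU12 hU21 hU22
    exact faceHi_anti (lt_of_lt_of_le hΔ₁ hD.1).le hC0 (by linarith [hb₁.trans hB.1]) hε0 hεh ((faceU_nonneg_iff _ _ _ _ _).1 hU)
  -- margins
  have hmof : ∀ {C ε : ℝ}, C ∈ Icc c₁ c₂ → ε ≤ Eh → 0 < ε → C * ε < a ^ 2 := by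
    intro C ε hC hεh hε0
    have hC0 : 0 ≤ C := hc₁.trans hC.1
    calc C * ε ≤ c₂ * Eh := mul_le_mul hC.2 hεh hε0.le hc₂
      _ < a ^ 2 := hm
  have hΔ₁m : Δ₁ ∈ Icc Δ₁ Δ₂ := ⟨le_rfl, hΔ.1.trans hΔ.2⟩
  have hΔ₂m : Δ₂ ∈ Icc Δ₁ Δ₂ := ⟨hΔ.1.trans hΔ.2, le_rfl⟩
  have hb₁m : b₁ ∈ Icc b₁ b₂ := ⟨le_rfl, hb.1.trans hb.2⟩
  have hb₂m : b₂ ∈ Icc b₁ b₂ := ⟨hb.1.trans hb.2, le_rfl⟩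
  have hc₁m : c₁ ∈ Icc c₁ c₂ := ⟨le_rfl, hc.1.trans hc.2⟩
  have hc₂m : c₂ ∈ Icc c₁ c₂ := ⟨hc.1.trans hc.2, le_rfl⟩
  have hεpos : ∀ {D B C : ℝ}, 0 < D → 0 ≤ B → 0 ≤ C → 0 < fermiEnergyOf D a B C ν :=
    fun hD hB hC => fermiEnergyOf_pos hD ha' hC hB hν0 hν1
  constructor
  · -- LOWER chain: W(Δ₁, b₂, c₁) ≤ W(Δ₁, b₂, c) ≤ W(Δ₁, b, c) ≤ W(Δ, b, c)
    have s3 : dWeightFace Δ₁ a b₂ c₁ (fermiEnergyOf Δ₁ a b₂ c₁ ν) ≤ dWeightFace Δ₁ a b₂ c (fermiEnergyOf Δ₁ a b₂ c ν) := by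
      refine dWeightFace_fermi_mono_tppP hΔ₁ ha hc₁ hc.1 (hc.2.trans (hcb.trans hb₂m.1)) hν0 hν1 (hGof hΔ₁m hb₂m hc₁m) (hGof hΔ₁m hb₂m hc)
        ?_ (hmof hc (hEmax hΔ₁m hb₂m hc₁m) (hεpos hΔ₁ hb₂ hc₁)) (hUof hΔ₁m hb₂m hc (hεpos hΔ₁ hb₂ hc₁) (hEmax hΔ₁m hb₂m hc₁m))
      have := hRmin hb₂m hc₁m
      linarith [hc.2]
    have s2 : dWeightFace Δ₁ a b₂ c (fermiEnergyOf Δ₁ a b₂ c ν) ≤ dWeightFace Δ₁ a b c (fermiEnergyOf Δ₁ a b c ν) :=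
      dWeightFace_fermi_anti_tpp hΔ₁ ha hc0 ((hc.2.trans hcb).trans hb.1) hb.2 hν0 hν1 (hGof hΔ₁m hb hc)
        (hmof hc (hEmax hΔ₁m hb₂m hc) (hεpos hΔ₁ hb₂ hc0)) (hUof hΔ₁m hb₂m hc (hεpos hΔ₁ hb₂ hc0) (hEmax hΔ₁m hb₂m hc))
    have s1 : dWeightFace Δ₁ a b c (fermiEnergyOf Δ₁ a b c ν) ≤ dWeightFace Δ a b c (fermiEnergyOf Δ a b c ν) := by
      refine dWeightFace_fermi_mono_Delta hΔ₁ hΔ.1 ha hc0 ((hc.2.trans hcb).trans hb.1) hν0 hν1 (hGof hΔ₁m hb hc) (hGof hΔ hb hc)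
        ?_ (hmof hc (hEmax hΔ₁m hb hc) (hεpos hΔ₁ hb0 hc0)) (hUof hΔ hb hc (hεpos hΔ₁ hb0 hc0) (hEmax hΔ₁m hb hc))
      have := hRmin hb hc
      linarith [hb.2, hc.2]
    exact s3.trans (s2.trans s1)
  · -- UPPER chain: W(Δ, b, c) ≤ W(Δ₂, b, c) ≤ W(Δ₂, b₁, c) ≤ W(Δ₂, b₁, c₂)
    have s1 : dWeightFace Δ a b c (fermiEnergyOf Δ a b c ν) ≤ dWeightFace Δ₂ a b c (fermiEnergyOf Δ₂ a b c ν) := by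
      refine dWeightFace_fermi_mono_Delta hΔ0 hΔ.2 ha hc0 ((hc.2.trans hcb).trans hb.1) hν0 hν1 (hGof hΔ hb hc) (hGof hΔ₂m hb hc)
        ?_ (hmof hc (hEmax hΔ hb hc) (hεpos hΔ0 hb0 hc0)) (hUof hΔ₂m hb hc (hεpos hΔ0 hb0 hc0) (hEmax hΔ hb hc))
      have h1 := hRmin hb hc
      have h2 := hLip hΔ hb hc
      linarith [hb.2, hc.2]
    have s2 : dWeightFace Δ₂ a b c (fermiEnergyOf Δ₂ a b c ν) ≤ dWeightFace Δ₂ a b₁ c (fermiEnergyOf Δ₂ a b₁ c ν) :=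
      dWeightFace_fermi_anti_tpp hΔ₂ ha hc0 (hc.2.trans hcb) hb.1 hν0 hν1 (hGof hΔ₂m hb₁m hc)
        (hmof hc (hEmax hΔ₂m hb hc) (hεpos hΔ₂ hb0 hc0)) (hUof hΔ₂m hb hc (hεpos hΔ₂ hb0 hc0) (hEmax hΔ₂m hb hc))
    have s3 : dWeightFace Δ₂ a b₁ c (fermiEnergyOf Δ₂ a b₁ c ν) ≤ dWeightFace Δ₂ a b₁ c₂ (fermiEnergyOf Δ₂ a b₁ c₂ ν) := by
      refine dWeightFace_fermi_mono_tppP hΔ₂ ha hc0 hc.2 hcb hν0 hν1 (hGof hΔ₂m hb₁m hc) (hGof hΔ₂m hb₁m hc₂m)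
        ?_ (hmof hc₂m (hEmax hΔ₂m hb₁m hc) (hεpos hΔ₂ hb₁ hc0)) (hUof hΔ₂m hb₁m hc₂m (hεpos hΔ₂ hb₁ hc0) (hEmax hΔ₂m hb₁m hc))
      -- 4(b₁ + c₂) ≤ Δ₂ + Ev ≤ Δ₂ + ε_F(Δ₂, a, b₁, c₂) ≤ Δ₂ + ε_F(Δ₂, a, b₁, c)
      obtain ⟨γ, hCγ⟩ : ∃ γ, c₂ = c + γ := ⟨c₂ - c, by ring⟩
      have hγ : 0 ≤ γ := by linarith [hc.2]
      have h3 : fermiEnergyOf Δ₂ a b₁ c₂ ν ≤ fermiEnergyOf Δ₂ a b₁ c ν := by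
        rw [hCγ]; exact fermiEnergyOf_anti_tppP hΔ₂ ha' hc0 hb₁ hγ hν0 hν1 (hex hΔ₂ hb₁ hc0) (hex hΔ₂ hb₁ (by linarith))
      linarith
    exact s1.trans (s2.trans s3)

/-- `dWeightFaceCF Δ a b c ε = a²·faceN/(a²·faceN + faceR)` — the closed form of `EmeryOrbitalWeightFace.dWeightFace_eq` as a function (for `norm_num` at corners). [folklore] -/
def dWeightFaceCF (Δ a b c ε : ℝ) : ℝ := a ^ 2 * faceN Δ b c ε / (a ^ 2 * faceN Δ b c ε + faceR Δ a b c ε)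

/-- `dWeightFace = dWeightFaceCF` on the window (`Δ + ε > 0`, `0 ≤ t_pp′ ≤ t_pp`, `ε > 0`, `t_pp′ε < a²`, `faceG ≥ 0`). [folklore] -/
theorem dWeightFace_eq_CF {Δ a b c ε : ℝ} (hE : 0 < Δ + ε) (hc : 0 ≤ c) (hcb : c ≤ b) (hε : 0 < ε) (hm : c * ε < a ^ 2) (hG : 0 ≤ faceG Δ a c ε) :
    dWeightFace Δ a b c ε = dWeightFaceCF Δ a b c ε := by
  have hD : 0 < fsD Δ a c ε := fsD_pos hE hm
  have hF : 0 < 4 * fsD Δ a c ε + 16 * fsN a b c ε := by have := fsN_nonneg (tpd := a) hc hcb hε.le; positivity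
  unfold dWeightFaceCF
  exact dWeightFace_eq hε.ne' hF.ne' (dcharCubic_face_pos hE hc hcb hε hm hG).ne'

/-- **NUMERIC FORM OF THE THREE-COORDINATE RULE**: with the two extreme corners' Fermi energies bracketed (`ε_F(Δ₁, a, b₂, c₁) ≤ E_h`, `E_v ≤ ε_F(Δ₂, a, b₁, c₂)` with
`faceG(Δ₂, a, c₂; E_v) ≥ 0`) and rational bounds `lo ≤ dWeightFaceCF(Δ₁, a, b₂, c₁; E_h)`, `dWeightFaceCF(Δ₂, a, b₁, c₂; E_v) ≤ hi`: **`W(Δ, a, b, c) ∈ [lo, hi]`** for every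
member. [folklore] -/
theorem dWeightFace_fermiEnergyOf_mem_Icc_of_mem_box3_num {Δ a b c Δ₁ Δ₂ b₁ b₂ c₁ c₂ ν Eh ER Ev lo hi : ℝ} (hΔ₁ : 0 < Δ₁) (ha : 0 < a) (hc₁ : 0 ≤ c₁)
    (hcb : c₂ ≤ b₁) (hΔ : Δ ∈ Icc Δ₁ Δ₂) (hb : b ∈ Icc b₁ b₂) (hc : c ∈ Icc c₁ c₂) (hν0 : 0 < ν) (hν1 : ν < 1)
    (hVH : ∀ Δ' b' c' : ℝ, Δ' ∈ Icc Δ₁ Δ₂ → b' ∈ Icc b₁ b₂ → c' ∈ Icc c₁ c₂ → 1 - 2 * ν ≤ xVH Δ' a b' c')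
    (hEh : fermiEnergyOf Δ₁ a b₂ c₁ ν ≤ Eh) (hm : c₂ * Eh < a ^ 2)
    (hU11 : 0 ≤ faceU Δ₁ a b₁ c₁ Eh) (hU12 : 0 ≤ faceU Δ₁ a b₁ c₂ Eh) (hU21 : 0 ≤ faceU Δ₂ a b₁ c₁ Eh) (hU22 : 0 ≤ faceU Δ₂ a b₁ c₂ Eh)
    (hER : ER ≤ fermiEnergyOf Δ₁ a b₁ c₂ ν) (hR1 : 4 * (b₂ + c₂) ≤ Δ₁ + ER)
    (hEv : Ev ≤ fermiEnergyOf Δ₂ a b₁ c₂ ν) (hR2 : 4 * (b₁ + c₂) ≤ Δ₂ + Ev) (hEv0 : 0 < Ev) (hGv : 0 ≤ faceG Δ₂ a c₂ Ev)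
    (hlo : lo ≤ dWeightFaceCF Δ₁ a b₂ c₁ Eh) (hhi : dWeightFaceCF Δ₂ a b₁ c₂ Ev ≤ hi) :
    dWeightFace Δ a b c (fermiEnergyOf Δ a b c ν) ∈ Icc lo hi := by
  have h := dWeightFace_fermiEnergyOf_mem_Icc_of_mem_box3 hΔ₁ ha hc₁ hcb hΔ hb hc hν0 hν1 hVH hEh hm hU11 hU12 hU21 hU22 hER hR1 hEv hR2
  have hΔ₂ : 0 < Δ₂ := lt_of_lt_of_le hΔ₁ (hΔ.1.trans hΔ.2)
  have hc₂ : 0 ≤ c₂ := hc₁.trans (hc.1.trans hc.2)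
  have hb₁ : 0 ≤ b₁ := hc₂.trans hcb
  have hb₂ : 0 ≤ b₂ := hb₁.trans (hb.1.trans hb.2)
  have ha' : a ≠ 0 := ha.ne'
  have hΔ₁m : Δ₁ ∈ Icc Δ₁ Δ₂ := ⟨le_rfl, hΔ.1.trans hΔ.2⟩
  have hΔ₂m : Δ₂ ∈ Icc Δ₁ Δ₂ := ⟨hΔ.1.trans hΔ.2, le_rfl⟩
  have hb₁m : b₁ ∈ Icc b₁ b₂ := ⟨le_rfl, hb.1.trans hb.2⟩
  have hb₂m : b₂ ∈ Icc b₁ b₂ := ⟨hb.1.trans hb.2, le_rfl⟩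
  have hc₁m : c₁ ∈ Icc c₁ c₂ := ⟨le_rfl, hc.1.trans hc.2⟩
  have hc₂m : c₂ ∈ Icc c₁ c₂ := ⟨hc.1.trans hc.2, le_rfl⟩
  -- every box point's Fermi energy lies below `Eh`
  have hEtop : ∀ {D B C : ℝ}, D ∈ Icc Δ₁ Δ₂ → B ∈ Icc b₁ b₂ → C ∈ Icc c₁ c₂ → fermiEnergyOf D a B C ν ≤ Eh := fun hD hB hC =>
    (fermiEnergyOf_mem_Icc_of_mem_box' hΔ₁ ha hb₁ hc₁ hD ⟨le_rfl, le_rfl⟩ hB hC hν0 hν1).2.trans hEh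
  have hEh0 : 0 < Eh := lt_of_lt_of_le (fermiEnergyOf_pos hΔ₁ ha' hc₁ hb₂ hν0 hν1) hEh
  -- the lower corner V_lo = (Δ₁, b₂, c₁): CF(V_lo; Eh) = W at Eh ≤ W at ε_F(V_lo)
  have hεlo : 0 < fermiEnergyOf Δ₁ a b₂ c₁ ν := fermiEnergyOf_pos hΔ₁ ha' hc₁ hb₂ hν0 hν1
  have hGlo : 0 ≤ faceG Δ₁ a c₁ (fermiEnergyOf Δ₁ a b₂ c₁ ν) :=
    faceG_fermiEnergyOf_nonneg_of_xVH hΔ₁ ha' hc₁ hb₂ hν0 hν1 (hVH Δ₁ b₂ c₁ hΔ₁m hb₂m hc₁m)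
  have hc₁b₂ : c₁ ≤ b₂ := (hc₁m.2.trans hcb).trans hb₁m.2
  have hmlo : c₁ * Eh < a ^ 2 := lt_of_le_of_lt (mul_le_mul_of_nonneg_right hc₁m.2 hEh0.le) hm
  have hUlo : cA Δ₁ Eh ≤ 8 * fsD Δ₁ a c₁ Eh + 16 * fsN a b₂ c₁ Eh :=
    (faceU_nonneg_iff _ _ _ _ _).1 (faceU_nonneg_on_box hEh0.le hb₁ hΔ₁m hb₂m.1 hc₁m hU11 hU12 hU21 hU22)
  have hlo' : dWeightFaceCF Δ₁ a b₂ c₁ Eh ≤ dWeightFace Δ₁ a b₂ c₁ (fermiEnergyOf Δ₁ a b₂ c₁ ν) := by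
    rw [← dWeightFace_eq_CF (by linarith) hc₁ hc₁b₂ hEh0 hmlo (hGlo.trans (faceG_mono hΔ₁.le hc₁ hεlo.le hEh))]
    exact dWeightFace_antitone hΔ₁ hc₁ hc₁b₂ ha' hεlo hEh hmlo hGlo hUlo
  -- the upper corner V_hi = (Δ₂, b₁, c₂): W at ε_F(V_hi) ≤ W at Ev = CF(V_hi; Ev)
  have hεhi : fermiEnergyOf Δ₂ a b₁ c₂ ν ≤ Eh := hEtop hΔ₂m hb₁m hc₂m
  have hmhi : c₂ * fermiEnergyOf Δ₂ a b₁ c₂ ν < a ^ 2 := lt_of_le_of_lt (mul_le_mul_of_nonneg_left hεhi hc₂) hm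
  have hmv : c₂ * Ev < a ^ 2 := lt_of_le_of_lt (mul_le_mul_of_nonneg_left (hEv.trans hεhi) hc₂) hm
  have hUhi : cA Δ₂ (fermiEnergyOf Δ₂ a b₁ c₂ ν) ≤ 8 * fsD Δ₂ a c₂ (fermiEnergyOf Δ₂ a b₁ c₂ ν) + 16 * fsN a b₁ c₂ (fermiEnergyOf Δ₂ a b₁ c₂ ν) :=
    faceHi_anti hΔ₂.le hc₂ (by linarith) (hEv0.trans_le hEv) hεhi ((faceU_nonneg_iff _ _ _ _ _).1 hU22)
  have hhi' : dWeightFace Δ₂ a b₁ c₂ (fermiEnergyOf Δ₂ a b₁ c₂ ν) ≤ dWeightFaceCF Δ₂ a b₁ c₂ Ev := by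
    rw [← dWeightFace_eq_CF (by linarith) hc₂ hcb hEv0 hmv hGv]
    exact dWeightFace_antitone hΔ₂ hc₂ hcb ha' hEv0 hEv hmhi hGv hUhi
  exact ⟨hlo.trans (hlo'.trans h.1), (h.2.trans hhi').trans hhi⟩

end Box3

/-! ## §5 The four-coordinate typed box, by normalisation to `t_pd = 1` -/

section Box4

/-- Ratio bounds: `a ∈ [a₁, a₂]` (`a₁ > 0`), `x ∈ [x₁, x₂]` (`x₁ ≥ 0`) ⇒ `x/a ∈ [x₁/a₂, x₂/a₁]`. [folklore] -/
theorem div_mem_Icc_of_mem {x a x₁ x₂ a₁ a₂ : ℝ} (ha₁ : 0 < a₁) (hx₁ : 0 ≤ x₁) (hx : x ∈ Icc x₁ x₂) (ha : a ∈ Icc a₁ a₂) :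
    x / a ∈ Icc (x₁ / a₂) (x₂ / a₁) := by
  have ha0 : 0 < a := lt_of_lt_of_le ha₁ ha.1
  have ha₂ : 0 < a₂ := lt_of_lt_of_le ha0 ha.2
  constructor
  · calc x₁ / a₂ ≤ x₁ / a := div_le_div_of_nonneg_left hx₁ ha0 ha.2
      _ ≤ x / a := div_le_div_of_nonneg_right hx.1 ha0.le
  · calc x / a ≤ x₂ / a := div_le_div_of_nonneg_right hx.2 ha0.le
      _ ≤ x₂ / a₁ := div_le_div_of_nonneg_left (hx₁.trans (hx.1.trans hx.2)) ha₁ ha.1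

/-- **THE ANTINODAL FERMI-SURFACE Cu-d WEIGHT OVER A TYPED FOUR-COORDINATE BOX (numeric form).** For every member `θ = (Δ, a, b, c)` of
`[Δ₁, Δ₂] × [a₁, a₂] × [b₁, b₂] × [c₁, c₂]` (`Δ₁ > 0`, `a₁ > 0`, `c₁ ≥ 0`) at filling `0 < ν < 1`: `W(θ) = W(Δ/a, 1, b/a, c/a)` and the normalised point lies in the box
`N = [Δ₁/a₂, Δ₂/a₁] × {1} × [b₁/a₂, b₂/a₁] × [c₁/a₂, c₂/a₁]`; the hypotheses are those of `dWeightFace_fermiEnergyOf_mem_Icc_of_mem_box3_num` ON `N` (hole-likeness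
`1 − 2ν ≤ x_VH` on `N`, the top Fermi energy `E_h` of `N` with its four upper-edge corner inequalities and `(c₂/a₁)E_h < 1`, the regime at the two corners of `N`, the
bracket `E_v` at `N`'s upper corner with `faceG ≥ 0` there, and the two closed-form corner values) ⇒ **`W(θ) ∈ [lo, hi]`**. [folklore] -/
theorem dWeightFace_fermiEnergyOf_mem_Icc_of_mem_box4_num {Δ a b c Δ₁ Δ₂ a₁ a₂ b₁ b₂ c₁ c₂ ν Eh ER Ev lo hi : ℝ} (hΔ₁ : 0 < Δ₁) (ha₁ : 0 < a₁)
    (hc₁ : 0 ≤ c₁) (hcb : c₂ / a₁ ≤ b₁ / a₂) (hΔ : Δ ∈ Icc Δ₁ Δ₂) (ha : a ∈ Icc a₁ a₂) (hb : b ∈ Icc b₁ b₂) (hc : c ∈ Icc c₁ c₂)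
    (hν0 : 0 < ν) (hν1 : ν < 1)
    (hVH : ∀ Δ' b' c' : ℝ, Δ' ∈ Icc (Δ₁ / a₂) (Δ₂ / a₁) → b' ∈ Icc (b₁ / a₂) (b₂ / a₁) → c' ∈ Icc (c₁ / a₂) (c₂ / a₁) → 1 - 2 * ν ≤ xVH Δ' 1 b' c')
    (hEh : fermiEnergyOf (Δ₁ / a₂) 1 (b₂ / a₁) (c₁ / a₂) ν ≤ Eh) (hm : c₂ / a₁ * Eh < 1)
    (hU11 : 0 ≤ faceU (Δ₁ / a₂) 1 (b₁ / a₂) (c₁ / a₂) Eh) (hU12 : 0 ≤ faceU (Δ₁ / a₂) 1 (b₁ / a₂) (c₂ / a₁) Eh)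
    (hU21 : 0 ≤ faceU (Δ₂ / a₁) 1 (b₁ / a₂) (c₁ / a₂) Eh) (hU22 : 0 ≤ faceU (Δ₂ / a₁) 1 (b₁ / a₂) (c₂ / a₁) Eh)
    (hER : ER ≤ fermiEnergyOf (Δ₁ / a₂) 1 (b₁ / a₂) (c₂ / a₁) ν) (hR1 : 4 * (b₂ / a₁ + c₂ / a₁) ≤ Δ₁ / a₂ + ER)
    (hEv : Ev ≤ fermiEnergyOf (Δ₂ / a₁) 1 (b₁ / a₂) (c₂ / a₁) ν) (hR2 : 4 * (b₁ / a₂ + c₂ / a₁) ≤ Δ₂ / a₁ + Ev) (hEv0 : 0 < Ev)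
    (hGv : 0 ≤ faceG (Δ₂ / a₁) 1 (c₂ / a₁) Ev)
    (hlo : lo ≤ dWeightFaceCF (Δ₁ / a₂) 1 (b₂ / a₁) (c₁ / a₂) Eh) (hhi : dWeightFaceCF (Δ₂ / a₁) 1 (b₁ / a₂) (c₂ / a₁) Ev ≤ hi) :
    dWeightFace Δ a b c (fermiEnergyOf Δ a b c ν) ∈ Icc lo hi := by
  have ha0 : 0 < a := lt_of_lt_of_le ha₁ ha.1
  have ha₂ : 0 < a₂ := lt_of_lt_of_le ha0 ha.2
  have hb₁ : 0 ≤ b₁ := by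
    have h1 : 0 ≤ c₂ / a₁ := div_nonneg (hc₁.trans (hc.1.trans hc.2)) ha₁.le
    have h2 : 0 ≤ b₁ / a₂ := h1.trans hcb
    by_contra hneg; push Not at hneg
    have : b₁ / a₂ < 0 := div_neg_of_neg_of_pos hneg ha₂
    linarith
  rw [dWeightFace_fermiEnergyOf_eq_ratios ha0]
  have hΔn := div_mem_Icc_of_mem ha₁ hΔ₁.le hΔ ha
  have hbn := div_mem_Icc_of_mem ha₁ hb₁ hb ha
  have hcn := div_mem_Icc_of_mem ha₁ hc₁ hc ha
  exact dWeightFace_fermiEnergyOf_mem_Icc_of_mem_box3_num (div_pos hΔ₁ ha₂) one_pos (div_nonneg hc₁ ha₂.le) hcb hΔn hbn hcn hν0 hν1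
    hVH hEh (by simpa using hm) hU11 hU12 hU21 hU22 hER hR1 hEv hR2 hEv0 hGv hlo hhi

end Box4

end Summit.Ventures.CertifiedManyBodySolver.Downfold.Emery
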